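import Literature.AlgebraicGeometry.HodgeTheory.WeilClassesFieldSubringMatricesDecomposable
import Literature.AlgebraicGeometry.HodgeTheory.WeilClassesFieldQuaternionEndLevel
import HarnessLib

/-!
# Moonen–Zarhin's Criterion (2), THE TYPE-2 ROWS ON POWERS `A^{n+1}` FROM `End(A)`: quaternion relations
# `α² = a(ψ)`, `β² = b(ψ)`, `αβ = -βα`, `ψα = αψ`, `ψβ = βψ` stated in `End(A)`, entries of `φ` in the subring
# `ℤ⟨ψ, α, β⟩`, ⟹ the Weil classes of `ℚ(φ)` are algebraic; centre `ℚ` as the case `ψ = 𝟙` (Moonen–Zarhin 1998 §1)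

Layer `Literature/AlgebraicGeometry/HodgeTheory`; THEOREMS ONLY — no definition, no named fact, no `sorry` (D-0026, net
debt 0).  The power companion of the seat's `WeilClassesFieldQuaternionEndLevel` (`m = 1`), on top of
`WeilClassesFieldSubringMatricesDecomposable`.

## The print

B. J. J. Moonen, Yu. G. Zarhin, *Weil classes on abelian varieties*, J. reine angew. Math. 496 (1998) 83–92 =
arXiv:alg-geom/9612017 [MoonenZarhin1998WeilClasses] (held text `paper:arxiv-alg-geom_9612017`), §1 Table 1 (chunk
p0002 L60–L84: Type 2, `B = M_m(D)`) and Criterion (2) with its proof (chunk p0003 L46–L90).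

## What is proved (`X = A^{n+1}`, product polarization)

* **`weilClassesField_biproduct_le_algebraicClasses_of_entry_mem_closure_quaternionOver_End`** — real-multiplication
  centre `ℚ(ψ)` of any degree, all algebra hypotheses in `End(A)`.
* **`weilClassesField_biproduct_le_algebraicClasses_of_entry_mem_closure_quaternionPair_End`** — centre `ℚ`
  (`α² = [a]`, `β² = [b]`), derived from the former at `ψ = 𝟙`, `Q = X - 1`.

Scope (honest column).  Rosati symmetry of `ψ, α, β` and the class `h` stay carrier hypotheses; integral entries.

## References

* [MoonenZarhin1998WeilClasses] B. J. J. Moonen, Yu. G. Zarhin, Weil classes on abelian varieties, J. reine angew.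
  Math. 496 (1998) 83–92; arXiv:alg-geom/9612017: §1 Table 1 (chunk p0002 L60–L118), Criterion (2) and its proof
  (chunk p0003 L46–L90).
* [LangeBirkenhake1992] H. Lange, Ch. Birkenhake, Complex Abelian Varieties (1992), §1.1, §5.1.
* [VoisinHodgeI2002] C. Voisin, Hodge Theory and Complex Algebraic Geometry I (CUP 2002), Thm. 11.30.

## Provenance

Lane `lit-hodgefound` (Track 2, Layer A), prover seat `lit-hodgefound-p21` (generation 21), row g21-#13.
-/

noncomputable section

open CategoryTheory CategoryTheory.Limits
open Literature.AlgebraicTopology.SingularHomology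
open Literature.AlgebraicGeometry.Motives
open Literature.AlgebraicGeometry.VanGeemen1994 (hodgeClassSpan pullbackOne)
open Literature.AlgebraicGeometry.Milne1999
open Literature.Geometry.Kaehler (lefschetzPow)
open Literature.Barriers.HodgeConjecture (divisorClassesSpan)
open Literature.LinearAlgebra
open Polynomial

namespace Literature.AlgebraicGeometry.HodgeTheory

section EndLevelPowers

variable {A : AbelianVariety ℂ} {h : complexBetti A.X 2} {n : ℕ} {ψ α β : A ⟶ A}
  {φ : ⨁ (fun _ : Fin (n + 1) => A) ⟶ ⨁ (fun _ : Fin (n + 1) => A)} {P Q qa qb : Polynomial ℤ} {e m : ℕ} {a b : ℤ}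

/-- **THE TYPE-2 ROW ON POWERS FROM `End(A)`**: on `A^{n+1}` with the product polarization, the Weil classes of
`F = ℚ(φ)`, `φ ∈ M_{n+1}(ℤ⟨ψ, α, β⟩)` (every entry `ιₐ ≫ φ ≫ π_b` in the subring generated by `ψ, α, β`), are ALGEBRAIC,
for `ψ ∈ End(A)` Rosati-symmetric with `Q(ψ) = 0` (`Q` monic irreducible over `ℚ`) and `α, β ∈ End(A)` Rosati-symmetric
with — IN `End(A)` — `ψα = αψ`, `ψβ = βψ`, `αβ = -βα`, `α² = a(ψ)`, `β² = b(ψ)`, `a, b ∈ ℤ[X]` non-vanishing at the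
complex roots of `Q` (`α², β² ∈ E₀^×`): `weilClassesField_biproduct_le_algebraicClasses_of_entry_mem_closure_quaternionOver`
(`WeilClassesFieldSubringMatricesDecomposable`) with the algebra hypotheses transported from `End(A)` to `H¹` by the
public pull-back calculus of `WeilClassesFieldQuaternionEndLevel`. [cite: MoonenZarhin1998WeilClasses, Introduction (chunk p0001 L10–L18), §1 Table 1 and Criterion (2), type 2 (chunk p0002 L60–L118, p0003 L46–L90)]
[cite: VoisinHodgeI2002, Thm. 11.30] -/
theorem weilClassesField_biproduct_le_algebraicClasses_of_entry_mem_closure_quaternionOver_End (hA : 0 < A.dim)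
    (hh : h ∈ hodgeClassSpan A.dim A.X 1) (htop : lefschetzPow h (A.dim - 1) 2 h ≠ 0)
    (hnd : ∀ x : complexBetti A.X 1, (∀ y, polarizationPairingOne A.X h (A.dim - 1) x y = 0) → x = 0)
    (hψsym : ∀ v w : complexBetti A.X 1, polarizationPairingOne A.X h (A.dim - 1) (pullbackOne A ψ v) w =
      polarizationPairingOne A.X h (A.dim - 1) v (pullbackOne A ψ w))
    (hQm : Q.Monic) (hQirr : Irreducible (Q.map (Int.castRingHom ℚ)))
    (hψQ : Polynomial.eval₂ (Int.castRingHom (CategoryTheory.End A)) (ψ : CategoryTheory.End A) Q = 0)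
    (hα2 : α ≫ α = Polynomial.eval₂ (Int.castRingHom (CategoryTheory.End A)) (ψ : CategoryTheory.End A) qa)
    (hqa : ∀ z : ℂ, (Q.map (Int.castRingHom ℂ)).IsRoot z → (qa.map (Int.castRingHom ℂ)).eval z ≠ 0)
    (hβ2 : β ≫ β = Polynomial.eval₂ (Int.castRingHom (CategoryTheory.End A)) (ψ : CategoryTheory.End A) qb)
    (hqb : ∀ z : ℂ, (Q.map (Int.castRingHom ℂ)).IsRoot z → (qb.map (Int.castRingHom ℂ)).eval z ≠ 0)
    (hanti : α ≫ β = -(β ≫ α))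
    (hαsym : ∀ v w : complexBetti A.X 1, polarizationPairingOne A.X h (A.dim - 1) (pullbackOne A α v) w =
      polarizationPairingOne A.X h (A.dim - 1) v (pullbackOne A α w))
    (hβsym : ∀ v w : complexBetti A.X 1, polarizationPairingOne A.X h (A.dim - 1) (pullbackOne A β v) w =
      polarizationPairingOne A.X h (A.dim - 1) v (pullbackOne A β w))
    (hψα : ψ ≫ α = α ≫ ψ) (hψβ : ψ ≫ β = β ≫ ψ)
    (hPm : P.Monic) (hPe : P.natDegree = e) (hPirr : Irreducible (P.map (Int.castRingHom ℚ)))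
    (hφ : Polynomial.eval₂ (Int.castRingHom (CategoryTheory.End (⨁ (fun _ : Fin (n + 1) => A))))
      (φ : CategoryTheory.End (⨁ (fun _ : Fin (n + 1) => A))) P = 0)
    (her : e * (2 * m) = 2 * ((n + 1) * A.dim))
    (hφe : ∀ a b, End.of (biproduct.ι (fun _ : Fin (n + 1) => A) a ≫ φ ≫ biproduct.π (fun _ : Fin (n + 1) => A) b) ∈
      Subring.closure {End.of ψ, End.of α, End.of β}) :
    weilClassesField (⨁ (fun _ : Fin (n + 1) => A)) φ P (2 * m) ≤ algebraicClasses (⨁ (fun _ : Fin (n + 1) => A)).X m := by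
  have hα2' : pullbackOne A α * pullbackOne A α = aeval (pullbackOne A ψ) (qa.map (Int.castRingHom ℂ)) := by
    rw [← pullbackOne_comp_eq_mul, hα2]
    exact pullbackOne_eval₂ ψ qa
  have hβ2' : pullbackOne A β * pullbackOne A β = aeval (pullbackOne A ψ) (qb.map (Int.castRingHom ℂ)) := by
    rw [← pullbackOne_comp_eq_mul, hβ2]
    exact pullbackOne_eval₂ ψ qb
  have hanti' : pullbackOne A α * pullbackOne A β = -(pullbackOne A β * pullbackOne A α) := by
    rw [← pullbackOne_comp_eq_mul, hanti, pullbackOne_neg_eq_neg, pullbackOne_comp_eq_mul]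
  have hψα' : pullbackOne A ψ * pullbackOne A α = pullbackOne A α * pullbackOne A ψ := by
    rw [← pullbackOne_comp_eq_mul, hψα, pullbackOne_comp_eq_mul]
  have hψβ' : pullbackOne A ψ * pullbackOne A β = pullbackOne A β * pullbackOne A ψ := by
    rw [← pullbackOne_comp_eq_mul, hψβ, pullbackOne_comp_eq_mul]
  exact weilClassesField_biproduct_le_algebraicClasses_of_entry_mem_closure_quaternionOver hA hh htop hnd hψsym hQm hQirr
    hψQ hα2' hqa hβ2' hqb hanti' hαsym hβsym hψα' hψβ' hPm hPe hPirr hφ her hφe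

/-- **THE TYPE-2 ROW ON POWERS WITH CENTRE `ℚ`, FROM `End(A)`**: `α² = [a]`, `β² = [b]` (`a, b ∈ ℤ ∖ {0}`), `αβ = -βα` in
`End(A)`, `α, β` Rosati-symmetric, `φ ∈ M_{n+1}(ℤ⟨α, β⟩)` (entries in the subring generated by `𝟙, α, β`) ⟹ the Weil
classes of `ℚ(φ)` on `A^{n+1}` are algebraic — the real-multiplication version at `ψ = 𝟙`, `Q = X - 1`, `a(ψ) = a`,
`b(ψ) = b`. [cite: MoonenZarhin1998WeilClasses, §1 Table 1 and Criterion (2), type 2 («B = M_m(D)»; chunk p0002 L60–L118, p0003 L46–L90)]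
[cite: VoisinHodgeI2002, Thm. 11.30] -/
theorem weilClassesField_biproduct_le_algebraicClasses_of_entry_mem_closure_quaternionPair_End (hA : 0 < A.dim)
    (hh : h ∈ hodgeClassSpan A.dim A.X 1) (htop : lefschetzPow h (A.dim - 1) 2 h ≠ 0)
    (hnd : ∀ x : complexBetti A.X 1, (∀ y, polarizationPairingOne A.X h (A.dim - 1) x y = 0) → x = 0)
    (ha : a ≠ 0) (hα2 : α ≫ α = a • 𝟙 A) (hb : b ≠ 0) (hβ2 : β ≫ β = b • 𝟙 A) (hanti : α ≫ β = -(β ≫ α))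
    (hαsym : ∀ v w : complexBetti A.X 1, polarizationPairingOne A.X h (A.dim - 1) (pullbackOne A α v) w =
      polarizationPairingOne A.X h (A.dim - 1) v (pullbackOne A α w))
    (hβsym : ∀ v w : complexBetti A.X 1, polarizationPairingOne A.X h (A.dim - 1) (pullbackOne A β v) w =
      polarizationPairingOne A.X h (A.dim - 1) v (pullbackOne A β w))
    (hPm : P.Monic) (hPe : P.natDegree = e) (hPirr : Irreducible (P.map (Int.castRingHom ℚ)))
    (hφ : Polynomial.eval₂ (Int.castRingHom (CategoryTheory.End (⨁ (fun _ : Fin (n + 1) => A))))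
      (φ : CategoryTheory.End (⨁ (fun _ : Fin (n + 1) => A))) P = 0)
    (her : e * (2 * m) = 2 * ((n + 1) * A.dim))
    (hφe : ∀ c d, End.of (biproduct.ι (fun _ : Fin (n + 1) => A) c ≫ φ ≫ biproduct.π (fun _ : Fin (n + 1) => A) d) ∈
      Subring.closure {End.of (𝟙 A), End.of α, End.of β}) :
    weilClassesField (⨁ (fun _ : Fin (n + 1) => A)) φ P (2 * m) ≤ algebraicClasses (⨁ (fun _ : Fin (n + 1) => A)).X m := by
  -- centre `ℚ`: take `ψ = 𝟙`, `Q = X - 1`, `a(ψ) = a`, `b(ψ) = b`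
  have h1sym : ∀ v w : complexBetti A.X 1, polarizationPairingOne A.X h (A.dim - 1) (pullbackOne A (𝟙 A) v) w =
      polarizationPairingOne A.X h (A.dim - 1) v (pullbackOne A (𝟙 A) w) := by
    intro v w
    rw [pullbackOne_id_eq_one, Module.End.one_apply, Module.End.one_apply]
  have hQm : (Polynomial.X - Polynomial.C (1 : ℤ)).Monic := Polynomial.monic_X_sub_C 1
  have hQirr : Irreducible ((Polynomial.X - Polynomial.C (1 : ℤ)).map (Int.castRingHom ℚ)) := by
    rw [Polynomial.map_sub, Polynomial.map_X, Polynomial.map_C, map_one]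
    exact Polynomial.irreducible_X_sub_C 1
  have hψQ : Polynomial.eval₂ (Int.castRingHom (CategoryTheory.End A)) (𝟙 A : CategoryTheory.End A)
      (Polynomial.X - Polynomial.C (1 : ℤ)) = 0 := by
    rw [Polynomial.eval₂_sub, Polynomial.eval₂_X, Polynomial.eval₂_C, map_one]
    exact sub_self _
  have hroot : ∀ z : ℂ, ((Polynomial.X - Polynomial.C (1 : ℤ)).map (Int.castRingHom ℂ)).IsRoot z → z = 1 := by
    intro z hz
    rw [Polynomial.map_sub, Polynomial.map_X, Polynomial.map_C, map_one, Polynomial.IsRoot.def, Polynomial.eval_sub,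
      Polynomial.eval_X, Polynomial.eval_C, sub_eq_zero] at hz
    exact hz
  have hα2' : α ≫ α = Polynomial.eval₂ (Int.castRingHom (CategoryTheory.End A)) (𝟙 A : CategoryTheory.End A)
      (Polynomial.C a) := by
    rw [Polynomial.eval₂_C, hα2]
    change a • (1 : CategoryTheory.End A) = _
    rw [zsmul_eq_mul, mul_one]
    rfl
  have hβ2' : β ≫ β = Polynomial.eval₂ (Int.castRingHom (CategoryTheory.End A)) (𝟙 A : CategoryTheory.End A)
      (Polynomial.C b) := by
    rw [Polynomial.eval₂_C, hβ2]
    change b • (1 : CategoryTheory.End A) = _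
    rw [zsmul_eq_mul, mul_one]
    rfl
  have hqa : ∀ z : ℂ, ((Polynomial.X - Polynomial.C (1 : ℤ)).map (Int.castRingHom ℂ)).IsRoot z →
      ((Polynomial.C a).map (Int.castRingHom ℂ)).eval z ≠ 0 := by
    intro z _
    rw [Polynomial.map_C, Polynomial.eval_C, eq_intCast]
    exact Int.cast_ne_zero.2 ha
  have hqb : ∀ z : ℂ, ((Polynomial.X - Polynomial.C (1 : ℤ)).map (Int.castRingHom ℂ)).IsRoot z →
      ((Polynomial.C b).map (Int.castRingHom ℂ)).eval z ≠ 0 := by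
    intro z _
    rw [Polynomial.map_C, Polynomial.eval_C, eq_intCast]
    exact Int.cast_ne_zero.2 hb
  exact weilClassesField_biproduct_le_algebraicClasses_of_entry_mem_closure_quaternionOver_End hA hh htop hnd h1sym hQm
    hQirr hψQ hα2' hqa hβ2' hqb hanti hαsym hβsym (by rw [Category.id_comp, Category.comp_id])
    (by rw [Category.id_comp, Category.comp_id]) hPm hPe hPirr hφ her hφe

end EndLevelPowers

end Literature.AlgebraicGeometry.HodgeTheory

end
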